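import Summits.QuantumAdvantage.AdviceFreeQNC0.AffBells23NearPerfect
import Summits.QuantumAdvantage.AdviceFreeQNC0.KernelFibrationMoves
import HarnessLib

/-!
# The antipodal 2-junta, step (i) of ask P-23h: on the odd class, WIN ⟺ an odd number of antipodal pairs `{t, t+h}` with
# `x_t ≠ x_{t+h}` AND `J_t ≠ J_{t+h}` (planner qn-p1 g23, ROUND-22 §2.8 / `AffBells23NearPerfect.lean` §3)

For the antipodal affine MOD₃ bell strategy `z_b(x) = [x_{b+1} + x_{b+h} ≡ 1 (3)] = x_{b+1} ⊕ x_{b+h}` on the cycle of even length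
`N = h + h` (`h ≥ 2`), and an input `x` of the odd class with kernel line `J = Fib19.kline x`:

* `affBell_antipodal` — the bell is the XOR `x_{b+1} ⊕ x_{b+h}`;
* `stake_antipodal` — its stake (deviation from the canonical guess `t_b = x_b ⊕ x_{b+1}`) is the ANTIPODAL DIFFERENCE `x_b ⊕ x_{b+h}`;
* `dot2_antipodalDiff` — pairing `b` with `b + h`: `⟨J, (x_b ⊕ x_{b+h})_b⟩ ≡ #{t < h : x_t ≠ x_{t+h} ∧ J_t ≠ J_{t+h}} (mod 2)`;
* **`antipodal_rel_iff`** — by `Fib19.rel_iff_stake`: `Rel x (z x) ⟺ #{t < h : x_t ≠ x_{t+h} ∧ J_t ≠ J_{t+h}}` is odd.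

This is the combinatorial form on the FOLDED cycle that the 16-state transfer matrix of P-23h (ii) evaluates (state
`(J_{t−1}, J_t ; J_{t+h−1}, J_{t+h})`, closing against the half-turn swap); steps (ii)–(iii) (the closed form `AntipodalValueFormula`)
are NOT done here.  Kernel data for `N = 6, 8` and the refutation of `AntipodalLeThreeQuarters` at `N = 6` are in
`AffBells23AntipodalSmall.lean`.
WHAT THIS IS NOT: no count; instrument for crux stmt-QuantumAdvantage-22907 (route DWalkThree); separation NOT moved.
-/

namespace Summit.QuantumAdvantage.AdviceFreeQNC0

namespace AffBells23

open Finset Literature.Computability.QuantumComplexity Literature.Computability.QuantumComplexity.RingHLF Fib19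

variable {h : ℕ}

/-- The antipodal partner `b + h` on the cycle `Fin (h + h)`. -/
def anti (b : Fin (h + h)) : Fin (h + h) := ⟨(b.val + h) % (h + h), Nat.mod_lt _ (by have := b.pos; omega)⟩

/-- `(b + 1) mod N ≠ (b + h) mod N` on the cycle of length `N = h + h`, `h ≥ 2`. -/
private theorem nxt_ne_anti (hh : 2 ≤ h) (b : Fin (h + h)) : (nxt b).val ≠ (anti b).val := by
  simp only [nxt, anti]
  have hb := b.isLt
  intro heq
  by_cases h1 : b.val + 1 < h + h
  · rw [Nat.mod_eq_of_lt h1] at heq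
    by_cases h2 : b.val + h < h + h
    · rw [Nat.mod_eq_of_lt h2] at heq; omega
    · rw [show b.val + h = (b.val + h - (h + h)) + (h + h) by omega, Nat.add_mod_right,
        Nat.mod_eq_of_lt (by omega)] at heq
      omega
  · rw [show b.val + 1 = h + h by omega, Nat.mod_self,
      show b.val + h = (h - 1) + (h + h) by omega, Nat.add_mod_right, Nat.mod_eq_of_lt (by omega)] at heq
    omega

/-- A single-position indicator summed against `x`. -/
private theorem sum_ite_pos (x : Fin (h + h) → Bool) (j : Fin (h + h)) :
    (∑ i : Fin (h + h), if x i = true then (if i.val = j.val then (1 : ZMod 3) else 0) else 0) =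
      if x j = true then 1 else 0 := by
  rw [Finset.sum_eq_single j]
  · simp
  · intro i _ hij
    have : i.val ≠ j.val := fun e => hij (Fin.ext e)
    simp [this]
  · intro hj; exact absurd (mem_univ j) hj

/-- **The antipodal bell is an XOR**: `[x_{b+1} + x_{b+h} ≡ 1 (3)] = x_{b+1} ⊕ x_{b+h}`. -/
theorem affBell_antipodal (hh : 2 ≤ h) (x : Fin (h + h) → Bool) (b : Fin (h + h)) :
    affBell (antipodalRows (h + h)) (fun _ => (1 : ZMod 3)) x b = xor (x (nxt b)) (x (anti b)) := by
  unfold affBell antipodalRows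
  have hN2 : (h + h) / 2 = h := by omega
  have hsplit : (∑ i : Fin (h + h), if x i = true then
      ((if i.val = (b.val + 1) % (h + h) then (1 : ZMod 3) else 0) +
        (if i.val = (b.val + (h + h) / 2) % (h + h) then (1 : ZMod 3) else 0)) else 0) =
      (if x (nxt b) = true then (1 : ZMod 3) else 0) + (if x (anti b) = true then 1 else 0) := by
    rw [hN2, ← sum_ite_pos x (nxt b), ← sum_ite_pos x (anti b), ← Finset.sum_add_distrib]
    refine Finset.sum_congr rfl fun i _ => ?_
    simp only [nxt, anti]
    split_ifs <;> simp
  rw [hsplit]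
  have hne := nxt_ne_anti hh b
  cases h1 : x (nxt b) <;> cases h2 : x (anti b) <;> simp

/-- **The stake of the antipodal strategy is the antipodal difference** `x_b ⊕ x_{b+h}`. -/
theorem stake_antipodal (hh : 2 ≤ h) (x : Fin (h + h) → Bool) (b : Fin (h + h)) :
    stake (fun y => affBell (antipodalRows (h + h)) (fun _ => (1 : ZMod 3)) y) x b = xor (x b) (x (anti b)) := by
  unfold stake tGuess
  beta_reduce
  rw [affBell_antipodal hh]
  cases x b <;> cases x (nxt b) <;> cases x (anti b) <;> rfl

/-- `anti` of a first-half position is the corresponding second-half position. -/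
private theorem anti_castAdd (t : Fin h) : anti (Fin.castAdd h t) = Fin.natAdd h t := by
  ext
  simp only [anti, Fin.val_castAdd, Fin.val_natAdd]
  rw [Nat.mod_eq_of_lt (by omega)]
  omega

/-- `anti` of a second-half position is the corresponding first-half position. -/
private theorem anti_natAdd (t : Fin h) : anti (Fin.natAdd h t) = Fin.castAdd h t := by
  ext
  simp only [anti, Fin.val_castAdd, Fin.val_natAdd]
  rw [show h + t.val + h = t.val + (h + h) by omega, Nat.add_mod_right, Nat.mod_eq_of_lt (by omega)]

/-- The Boolean bookkeeping of one antipodal pair: `[J₁ ∧ d] + [J₂ ∧ d] ≡ [d ∧ J₁ ≠ J₂] (mod 2)`. -/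
private theorem pair_mod_two (J₁ J₂ x₁ x₂ : Bool) :
    ((if (J₁ = true ∧ xor x₁ x₂ = true) then 1 else 0) + (if (J₂ = true ∧ xor x₂ x₁ = true) then 1 else 0)) % 2 =
      (if (x₁ ≠ x₂ ∧ J₁ ≠ J₂) then 1 else 0 : ℕ) := by
  cases J₁ <;> cases J₂ <;> cases x₁ <;> cases x₂ <;> decide

/-- **Pairing `b` with `b + h`**: `⟨J, (x_b ⊕ x_{b+h})_b⟩ ≡ #{t < h : x_t ≠ x_{t+h} ∧ J_t ≠ J_{t+h}} (mod 2)`. -/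
theorem dot2_antipodalDiff (J x : Fin (h + h) → Bool) :
    dot2 J (fun b => xor (x b) (x (anti b))) =
      (univ.filter fun t : Fin h => x (Fin.castAdd h t) ≠ x (Fin.natAdd h t) ∧
        J (Fin.castAdd h t) ≠ J (Fin.natAdd h t)).card % 2 := by
  unfold dot2
  rw [Finset.card_filter, Finset.card_filter, Fin.sum_univ_add, ← Finset.sum_add_distrib, Finset.sum_nat_mod,
    Finset.sum_congr rfl fun t _ => ?_, ← Finset.sum_nat_mod]
  beta_reduce
  rw [anti_castAdd, anti_natAdd]
  have e := pair_mod_two (J (Fin.castAdd h t)) (J (Fin.natAdd h t)) (x (Fin.castAdd h t)) (x (Fin.natAdd h t))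
  rw [e]
  split_ifs <;> rfl

/-- **P-23h (i): the antipodal win condition on the folded cycle.**  For `h ≥ 2` and an input `x` of the odd class of the
cycle of length `h + h`, the antipodal strategy wins iff the number of antipodal pairs `{t, t+h}` with `x_t ≠ x_{t+h}` and
`J_t ≠ J_{t+h}` (`J = kline x`) is odd. -/
theorem antipodal_rel_iff (hh : 2 ≤ h) (x : Fin (h + h) → Bool) (hx : OddZeros x) :
    RingHLF.Rel x (affBell (antipodalRows (h + h)) (fun _ => (1 : ZMod 3)) x) ↔
      (univ.filter fun t : Fin h => x (Fin.castAdd h t) ≠ x (Fin.natAdd h t) ∧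
        kline x (Fin.castAdd h t) ≠ kline x (Fin.natAdd h t)).card % 2 = 1 := by
  have hodd : IsOdd x := (isOdd_iff_oddZeros x).2 hx
  have key := rel_iff_stake (show 3 ≤ h + h by omega)
    (fun y => affBell (antipodalRows (h + h)) (fun _ => (1 : ZMod 3)) y) x hodd
  have hstake : stake (fun y => affBell (antipodalRows (h + h)) (fun _ => (1 : ZMod 3)) y) x =
      fun b => xor (x b) (x (anti b)) := funext fun b => stake_antipodal hh x b
  rw [hstake, dot2_antipodalDiff] at key
  exact key

end AffBells23

end Summit.QuantumAdvantage.AdviceFreeQNC0
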